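import Mathlib
import Summits.NavierStokesRegularity.NavierStokesRegularity.Theorems.EulerZoomLiouvillePowerGaugeEulerLiouvilleSelfSimilarDegenerateNodeBasin
import Summits.NavierStokesRegularity.NavierStokesRegularity.Theorems.EulerZoomLiouvillePowerGaugeEulerLiouvilleSelfSimilarBackwardDrift
import Summits.NavierStokesRegularity.NavierStokesRegularity.Theorems.EulerZoomLiouvillePowerGaugeEulerLiouvilleSelfSimilarFiniteHyperbolicFarField
import Summits.NavierStokesRegularity.NavierStokesRegularity.Theorems.EulerZoomLiouvillePowerGaugeEulerLiouvilleSelfSimilarLimitSetKill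
import HarnessLib

/-!
# Rung C1 of the crux `EulerZoomLiouville.PowerGaugeEulerLiouville`: orbits feeding a TRANSVERSALLY-SADDLE STAGNATION
# CONTINUUM form a null set (finite ball cover + dominated cone lemma + drift control)
# (route №10, item stmt-NavierStokesRegularity-19832; `--supports`)

Helper file (theorems only). Seat ns-typeII-p3 (cell ns-regularity-ideate §B, D-0081).  Assembly of the lane
«thin without hyperbolicity + drift control» for the uncountable-nodal-set residue of rung C1 (after typeII-p2's
`eq_zero_of_countable_nodalSet`): let `K` be a COMPACT piece of the stagnation set of `W = γy + V` at every point of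
which the linearisation `DW(z)` has the real block normal form `A b₀ = d₀b₀ − βb₁`, `A b₁ = βb₀ + d₁b₁`, `A b₂ = d₂b₂`
with `d₂ < 0`, `d₂ < d₀`, `d₂ < d₁` — ONE strictly contracting direction dominated by the block plane, no sign
condition on `d₀, d₁` (the degenerate portrait `(s+γ, 0, 2γ−s)` of nodes on a stagnation curve, typeII-p1 g7).

* `exists_trappedSet_null_of_dominatedBlock` — at such a node `z` there are a sampling time `T > 0` and a radius
  `r > 0` such that the set of points admitting a `Φ_T`-past history inside `B(z, r)` is Lebesgue-null (dominated cone
  lemma `hausdorffMeasure_localTrappedSet_eq_zero_of_dominated` for `F = Φ_T`, `DF(z) = exp(T·DW(z))`; NO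
  convergence to `z` required);
* **`volume_setOf_tendsto_flow_atBot_mem_eq_zero_of_dominatedBlock`** — hence the set of points whose backward
  trajectory CONVERGES TO SOME POINT OF `K` is Lebesgue-null (finite sub-cover of `K` by the half-balls; a trajectory
  converging to `z ∈ B(zᵢ, rᵢ/2)` is eventually trapped in `B(zᵢ, rᵢ)`; integer sampling; `C¹` images of null sets);
* **`volume_setOf_mapClusterPt_subset_eq_zero_of_driftCoordinate`** — if moreover a neighbourhood `U` of `K` carries a
  drift coordinate (`C¹` map `f`, `‖Df(y)W(y)‖ ≤ C‖W(y)‖²` on `U`, injective on `𝒩_W ∩ U`;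
  `tendsto_flow_atBot_of_driftCoordinate`), then the set of points ALL OF WHOSE BACKWARD CLUSTER POINTS LIE IN `K` is
  Lebesgue-null — drift along the continuum is impossible, every such trajectory converges to one node of `K`, and
  the previous statement applies.  (Profile hypotheses: `0 < γ < ½`, `V` smooth bounded, `‖DV‖ ≤ K`, `P` bounded
  above — only for the drift step.)

* **`eq_zero_of_driftCoordinate_of_dominatedBlock_badNodes` — AN EXCLUSION THEOREM FOR A CLASS OF UNCOUNTABLE
  STAGNATION SETS.**  `0 < γ < ½`, `V` smooth with CIV's far field (3.8): if (i) a neighbourhood `U` of the whole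
  stagnation set carries a drift coordinate `f` injective on `𝒩_W` (tubular coordinate along stagnation curves,
  locally constant near isolated nodes), and (ii) every BAD node (`⟪DV(z)w,w⟫ ≥ 1` for a unit `w`; typeII-p1's
  `exists_badNode_mapClusterPt_of_curl_ne_zero`: each vortical particle is backward-asymptotic to one) lies in a
  compact `Kset ⊆ 𝒩_W` carrying the dominated block form, then `V ≡ 0`: every backward trajectory converges to a
  single node, vortical ones to bad nodes, so `{curl V ≠ 0}` is an open null set, hence empty.

Reading for the residue: a transversally-saddle stagnation curve with a drift coordinate (e.g. a transversally
nondegenerate `C²` curve with a tubular coordinate) feeds vorticity to at most a null set of points; since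
`{curl V ≠ 0}` is open, vorticity must be fed by trajectories whose cluster set LEAVES every such piece — i.e. meets
nodes without a dominated contracting direction (`spec DW ⊆ {Re ≥ 0}` up to the kernel: transversally repelling
«source curves», cf. `…SelfSimilarSourceTube`) or pieces without drift control.

WHAT THIS IS NOT: not NS, not E, not rung C1 — measure-zero assembly for classical profiles; the block data along
`K` and the drift coordinate are HYPOTHESES.  [folklore; cf. Aulbach1984 Thms 2.3/4.1 (statements);
Robinson1999 Ch. V §5.10.1; ConstantinIgnatovaVicol2026Putative §3.5]
-/

noncomputable section

-- flat `Theorems/<Route><Decl>…` files of one crux share the namespace of the crux (tree convention)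
set_option linter.dupNamespace false

open MeasureTheory Set Filter Topology Metric Function InnerProductSpace
open scoped RealInnerProductSpace NNReal ContDiff

namespace Summit.NavierStokesRegularity.NavierStokesRegularity.Theorems.PowerGaugeEulerLiouville.Kelvin

open Literature.Analysis Literature.Analysis.FluidPDE Literature.Dynamics.FixedPoints

variable {γ : ℝ} {V : EuclideanSpace ℝ (Fin 3) → EuclideanSpace ℝ (Fin 3)} {P : EuclideanSpace ℝ (Fin 3) → ℝ}

/-! ### The trapped set near a node with a dominated contracting direction is null -/

/-- **Null trapped set at a dominated-block node.**  `V` smooth with `‖DV‖ ≤ K`, `z ∈ 𝒩_W`, `DW(z)` in real block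
form with `d₂ < 0`, `d₂ < d₀`, `d₂ < d₁`: there are `T > 0` and `r > 0` such that the set of points admitting a
`Φ_T`-past history inside `B(z, r)` is Lebesgue-null. [cite: Robinson1999, Ch. V §5.10.1 (cone estimate, dominated form; proved in the tree)] -/
theorem exists_trappedSet_null_of_dominatedBlock (hV : ContDiff ℝ ∞ V) {K : ℝ} (hK : ∀ y, ‖fderiv ℝ V y‖ ≤ K)
    {z : EuclideanSpace ℝ (Fin 3)} (hz : z ∈ selfSimilarNodalSet γ 0 V)
    (b : Module.Basis (Fin 3) ℝ (EuclideanSpace ℝ (Fin 3))) (lam : Fin 3 → ℝ) (β : ℝ)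
    (hA0 : (γ • ContinuousLinearMap.id ℝ (EuclideanSpace ℝ (Fin 3)) + fderiv ℝ V z) (b 0) = lam 0 • b 0 - β • b 1)
    (hA1 : (γ • ContinuousLinearMap.id ℝ (EuclideanSpace ℝ (Fin 3)) + fderiv ℝ V z) (b 1) = β • b 0 + lam 1 • b 1)
    (hA2 : (γ • ContinuousLinearMap.id ℝ (EuclideanSpace ℝ (Fin 3)) + fderiv ℝ V z) (b 2) = lam 2 • b 2)
    (h2 : lam 2 < 0) (h20 : lam 2 < lam 0) (h21 : lam 2 < lam 1) :
    ∃ T : ℝ, 0 < T ∧ ∃ r : ℝ, 0 < r ∧ volume {q : EuclideanSpace ℝ (Fin 3) | ∃ qs : ℕ → EuclideanSpace ℝ (Fin 3),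
      qs 0 = q ∧ (∀ k, ODE.evolutionMap (fun _ : ℝ => selfSimilarTransport γ 0 V) 0 T (qs (k + 1)) = qs k) ∧
        ∀ k, qs k ∈ ball z r} = 0 := by
  set A : EuclideanSpace ℝ (Fin 3) →L[ℝ] EuclideanSpace ℝ (Fin 3) :=
    γ • ContinuousLinearMap.id ℝ (EuclideanSpace ℝ (Fin 3)) + fderiv ℝ V z with hA
  obtain ⟨c, hc, hplane⟩ := le_norm_exp_smul_apply_of_span_pair A b lam β hA0 hA1
  set μ : ℝ := min (lam 0) (lam 1) with hμ
  have hμ2 : lam 2 < μ := lt_min h20 h21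
  set κ : ℝ := μ - lam 2 with hκ
  have hκ0 : 0 < κ := by rw [hκ]; linarith
  set T : ℝ := (1 / c) / κ + 1 with hTdef
  have hT0 : 0 < T := by rw [hTdef]; positivity
  have hrate : Real.exp (lam 2 * T) < c * Real.exp (μ * T) := by
    have h1 : 1 / c < Real.exp (κ * T) := by
      have h2 : κ * T = 1 / c + κ := by rw [hTdef]; field_simp
      have h3 := Real.add_one_le_exp (κ * T)
      rw [h2] at h3 ⊢
      linarith
    have h4 : Real.exp (μ * T) = Real.exp (lam 2 * T) * Real.exp (κ * T) := by
      rw [← Real.exp_add]; congr 1; rw [hκ]; ring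
    rw [h4]
    have h5 : 1 < c * Real.exp (κ * T) := by
      have := (div_lt_iff₀' hc).1 h1
      linarith
    nlinarith [Real.exp_pos (lam 2 * T)]
  have hexp := fderiv_flow_eq_exp_smul hV hK hz T
  have hF : ContDiff ℝ 1 (ODE.evolutionMap (fun _ : ℝ => selfSimilarTransport γ 0 V) 0 T) :=
    (contDiff_flow (γ := γ) hV hK T).of_le (by norm_cast)
  obtain ⟨r, hr, hnull⟩ := hausdorffMeasure_localTrappedSet_eq_zero_of_dominated (p := z) hF
    (Es := Submodule.span ℝ {b 2}) (Ec := Submodule.span ℝ {b 0, b 1}) (isCompl_span_singleton_span_pair b)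
    (fun x hx => by rw [hexp]; exact exp_smul_apply_mem A (mapsTo_span_singleton_of_blockBasis A b lam hA2) hx T)
    (fun x hx => by rw [hexp]; exact exp_smul_apply_mem A (mapsTo_span_pair_of_blockBasis A b lam β hA0 hA1) hx T)
    (a := Real.exp (lam 2 * T)) (b := c * Real.exp (μ * T))
    (by
      have : lam 2 * T < 0 := mul_neg_of_neg_of_pos h2 hT0
      calc Real.exp (lam 2 * T) < Real.exp 0 := Real.exp_lt_exp.2 this
        _ = 1 := Real.exp_zero)
    hrate
    (fun x hx => by rw [hexp]; exact norm_exp_smul_apply_le_of_eigenline A b lam hA2 hx hT0.le)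
    (fun x hx => by rw [hexp]; exact hplane T hT0.le x hx) (span_pair_ne_top b)
  exact ⟨T, hT0, r, hr,
    (Measure.absolutelyContinuous_isAddHaarMeasure volume (μH[Module.finrank ℝ (EuclideanSpace ℝ (Fin 3))])) hnull⟩

/-! ### Orbits converging into a compact dominated-block piece of the stagnation set form a null set -/

/-- Integer iterates of a sampling map are flow times: `(Φ_T)^[n] = Φ_{nT}`. [folklore] -/
theorem iterate_flow_eq (hV : ContDiff ℝ ∞ V) {K : ℝ} (hK : ∀ y, ‖fderiv ℝ V y‖ ≤ K) (T : ℝ) (n : ℕ)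
    (y : EuclideanSpace ℝ (Fin 3)) :
    (ODE.evolutionMap (fun _ : ℝ => selfSimilarTransport γ 0 V) 0 T)^[n] y =
      ODE.evolutionMap (fun _ : ℝ => selfSimilarTransport γ 0 V) 0 ((n : ℝ) * T) y := by
  induction n with
  | zero => simp
  | succ n ih =>
      rw [Function.iterate_succ_apply', ih, ← flow_add (γ := γ) hV hK]
      congr 1; push_cast; ring

/-- **ORBITS CONVERGING INTO A TRANSVERSALLY-SADDLE STAGNATION CONTINUUM FORM A NULL SET.**  Let `V` be smooth with
`‖DV‖ ≤ K` and `Kset ⊆ 𝒩_W` compact, with the dominated block form (`d₂ < 0`, `d₂ < d₀`, `d₂ < d₁`) of `DW(z)` at every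
`z ∈ Kset`.  Then `volume {x | ∃ z ∈ Kset, Φ_s x → z as s → −∞} = 0`.  [cite: Robinson1999, Ch. V §5.10.1 (cone estimate, dominated form; proved in the tree)] -/
theorem volume_setOf_tendsto_flow_atBot_mem_eq_zero_of_dominatedBlock (hV : ContDiff ℝ ∞ V) {K : ℝ}
    (hK : ∀ y, ‖fderiv ℝ V y‖ ≤ K) {Kset : Set (EuclideanSpace ℝ (Fin 3))} (hKc : IsCompact Kset)
    (hKN : Kset ⊆ selfSimilarNodalSet γ 0 V)
    (hblock : ∀ z ∈ Kset, ∃ (b : Module.Basis (Fin 3) ℝ (EuclideanSpace ℝ (Fin 3))) (lam : Fin 3 → ℝ) (β : ℝ),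
      (γ • ContinuousLinearMap.id ℝ (EuclideanSpace ℝ (Fin 3)) + fderiv ℝ V z) (b 0) = lam 0 • b 0 - β • b 1 ∧
      (γ • ContinuousLinearMap.id ℝ (EuclideanSpace ℝ (Fin 3)) + fderiv ℝ V z) (b 1) = β • b 0 + lam 1 • b 1 ∧
      (γ • ContinuousLinearMap.id ℝ (EuclideanSpace ℝ (Fin 3)) + fderiv ℝ V z) (b 2) = lam 2 • b 2 ∧
      lam 2 < 0 ∧ lam 2 < lam 0 ∧ lam 2 < lam 1) :
    volume {x : EuclideanSpace ℝ (Fin 3) | ∃ z ∈ Kset,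
      Tendsto (fun s => ODE.evolutionMap (fun _ : ℝ => selfSimilarTransport γ 0 V) 0 s x) atBot (𝓝 z)} = 0 := by
  set Φ := ODE.evolutionMap (fun _ : ℝ => selfSimilarTransport γ 0 V) 0 with hΦ
  -- sampling time, radius and null trapped set at every node of `Kset`
  have hdata : ∀ z ∈ Kset, ∃ T : ℝ, 0 < T ∧ ∃ r : ℝ, 0 < r ∧ volume {q : EuclideanSpace ℝ (Fin 3) |
      ∃ qs : ℕ → EuclideanSpace ℝ (Fin 3), qs 0 = q ∧ (∀ k, Φ T (qs (k + 1)) = qs k) ∧ ∀ k, qs k ∈ ball z r} = 0 := by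
    intro z hz
    obtain ⟨b, lam, β, hA0, hA1, hA2, h2, h20, h21⟩ := hblock z hz
    exact exists_trappedSet_null_of_dominatedBlock hV hK (hKN hz) b lam β hA0 hA1 hA2 h2 h20 h21
  choose! T hT r hr hnull using hdata
  -- finite sub-cover of `Kset` by the half-balls
  obtain ⟨t, htK, hcover⟩ := hKc.elim_nhds_subcover (fun z => ball z (r z / 2))
    (fun z hz => ball_mem_nhds z (half_pos (hr z hz)))
  -- the countable family of null sets `(Φ_{T i})^[n] '' W_i`
  have hWnull : ∀ i ∈ t, ∀ n : ℕ, volume ((Φ (T i))^[n] '' {q : EuclideanSpace ℝ (Fin 3) |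
      ∃ qs : ℕ → EuclideanSpace ℝ (Fin 3), qs 0 = q ∧ (∀ k, Φ (T i) (qs (k + 1)) = qs k) ∧
        ∀ k, qs k ∈ ball i (r i)}) = 0 := by
    intro i hi n
    have hFd : Differentiable ℝ (Φ (T i)) := (contDiff_flow (γ := γ) hV hK (T i)).differentiable (by simp)
    exact addHaar_image_eq_zero_of_differentiableOn_of_addHaar_eq_zero volume (hFd.iterate n).differentiableOn
      (hnull i (htK i hi))
  refine measure_mono_null (fun x hx => ?_)
    ((measure_biUnion_null_iff t.countable_toSet).2 fun i hi => measure_iUnion_null (hWnull i hi))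
  obtain ⟨z, hzK, hz⟩ := hx
  -- `z` lies in a half-ball `B(i, r i / 2)`, so the trajectory is eventually in `B(i, r i)`
  obtain ⟨i, hi, hzi⟩ := mem_iUnion₂.1 (hcover hzK)
  have hri : 0 < r i := hr i (htK i hi)
  have hsub : ball z (r i / 2) ⊆ ball i (r i) := by
    intro y hy
    rw [mem_ball] at hy hzi ⊢
    calc dist y i ≤ dist y z + dist z i := dist_triangle _ _ _
      _ < r i / 2 + r i / 2 := add_lt_add hy hzi
      _ = r i := by ring
  have hev : ∀ᶠ s in atBot, Φ s x ∈ ball i (r i) :=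
    (hz.eventually (ball_mem_nhds z (half_pos hri))).mono fun s hs => hsub hs
  obtain ⟨S, hS⟩ := eventually_atBot.1 hev
  -- integer sampling: `n` with `−n T i ≤ S`
  obtain ⟨n, hn⟩ := exists_nat_ge (-S / T i)
  have hTi : 0 < T i := hT i (htK i hi)
  have hnS : -((n : ℝ) * T i) ≤ S := by
    have := (div_le_iff₀ hTi).1 hn
    linarith
  refine mem_iUnion₂.2 ⟨i, hi, mem_iUnion.2 ⟨n, ?_⟩⟩
  -- the history `k ↦ Φ (−(n+k) T i) x` is trapped in the ball and starts at `Φ (−n T i) x`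
  have hmem : Φ (-((n : ℝ) * T i)) x ∈ {q : EuclideanSpace ℝ (Fin 3) |
      ∃ qs : ℕ → EuclideanSpace ℝ (Fin 3), qs 0 = q ∧ (∀ k, Φ (T i) (qs (k + 1)) = qs k) ∧
        ∀ k, qs k ∈ ball i (r i)} := by
    refine ⟨fun k => Φ (-(((n : ℝ) + k) * T i)) x, by simp, fun k => ?_, fun k => hS _ ?_⟩
    · show Φ (T i) (Φ (-(((n : ℝ) + ((k + 1 : ℕ) : ℝ)) * T i)) x) = Φ (-(((n : ℝ) + k) * T i)) x
      rw [hΦ, ← flow_add (γ := γ) hV hK]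
      congr 1; push_cast; ring
    · have hk : (0 : ℝ) ≤ k := Nat.cast_nonneg k
      nlinarith
  refine ⟨Φ (-((n : ℝ) * T i)) x, hmem, ?_⟩
  rw [hΦ, iterate_flow_eq hV hK, ← flow_add (γ := γ) hV hK, add_neg_cancel]
  exact flow_zero x

/-! ### With a drift coordinate: trajectories whose cluster set lies in the continuum form a null set -/

/-- **DRIFT CONTROL + THIN CONTINUUM.**  Let `(V, P)` be a classical in-window profile (`0 < γ < ½`, `V` smooth
bounded, `‖DV‖ ≤ K`, `P` bounded above), `Kset ⊆ 𝒩_W` compact with the dominated block form at every point, and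
`U ⊇ Kset` open with a drift coordinate `f` (`C¹`, `‖Df(y)W(y)‖ ≤ C‖W(y)‖²` on `U`, injective on `𝒩_W ∩ U`).  Then the
set of points all of whose backward cluster points lie in `Kset` is Lebesgue-null: such a trajectory converges to a
single node (`tendsto_flow_atBot_of_driftCoordinate`), which is one of its cluster points, hence in `Kset`.
[folklore; cf. Aulbach1984 Thms 2.3/4.1 (normally hyperbolic manifolds of equilibria; statements)] -/
theorem volume_setOf_mapClusterPt_subset_eq_zero_of_driftCoordinate (hV : ContDiff ℝ ∞ V) {K : ℝ}
    (hK : ∀ y, ‖fderiv ℝ V y‖ ≤ K) (hprof : IsSelfSimilarEulerProfile γ 0 V P) {M P₀ : ℝ} (hM : ∀ y, ‖V y‖ ≤ M)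
    (hP : ∀ y, P y ≤ P₀) (hγ : 0 < γ) (hγ2 : γ < 1 / 2)
    {Kset : Set (EuclideanSpace ℝ (Fin 3))} (hKc : IsCompact Kset) (hKN : Kset ⊆ selfSimilarNodalSet γ 0 V)
    (hblock : ∀ z ∈ Kset, ∃ (b : Module.Basis (Fin 3) ℝ (EuclideanSpace ℝ (Fin 3))) (lam : Fin 3 → ℝ) (β : ℝ),
      (γ • ContinuousLinearMap.id ℝ (EuclideanSpace ℝ (Fin 3)) + fderiv ℝ V z) (b 0) = lam 0 • b 0 - β • b 1 ∧
      (γ • ContinuousLinearMap.id ℝ (EuclideanSpace ℝ (Fin 3)) + fderiv ℝ V z) (b 1) = β • b 0 + lam 1 • b 1 ∧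
      (γ • ContinuousLinearMap.id ℝ (EuclideanSpace ℝ (Fin 3)) + fderiv ℝ V z) (b 2) = lam 2 • b 2 ∧
      lam 2 < 0 ∧ lam 2 < lam 0 ∧ lam 2 < lam 1)
    {U : Set (EuclideanSpace ℝ (Fin 3))} (hU : IsOpen U) (hKU : Kset ⊆ U)
    {F' : Type*} [NormedAddCommGroup F'] [NormedSpace ℝ F'] [CompleteSpace F']
    {f : EuclideanSpace ℝ (Fin 3) → F'} (hf : ContDiff ℝ 1 f) {C : ℝ}
    (hdrift : ∀ y ∈ U, ‖fderiv ℝ f y (selfSimilarTransport γ 0 V y)‖ ≤ C * ‖selfSimilarTransport γ 0 V y‖ ^ 2)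
    (hinj : InjOn f (selfSimilarNodalSet γ 0 V ∩ U)) :
    volume {x : EuclideanSpace ℝ (Fin 3) | ∀ z, MapClusterPt z atBot
      (fun s => ODE.evolutionMap (fun _ : ℝ => selfSimilarTransport γ 0 V) 0 s x) → z ∈ Kset} = 0 := by
  refine measure_mono_null (fun x hx => ?_)
    (volume_setOf_tendsto_flow_atBot_mem_eq_zero_of_dominatedBlock hV hK hKc hKN hblock)
  have hclU : ∀ z, MapClusterPt z atBot
      (fun s => ODE.evolutionMap (fun _ : ℝ => selfSimilarTransport γ 0 V) 0 s x) → z ∈ U :=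
    fun z hz => hKU (hx z hz)
  obtain ⟨z, -, hz⟩ := tendsto_flow_atBot_of_driftCoordinate hV hK hprof hM hP hγ hγ2 x hU hclU hf hdrift hinj
  exact ⟨z, hx z (hz.mapClusterPt), hz⟩

/-! ### An exclusion theorem: drift coordinate + dominated-block bad nodes ⇒ trivial -/

/-- **EXCLUSION FOR TRANSVERSALLY-SADDLE STAGNATION CONTINUA WITH DRIFT CONTROL.**  Let `(V, P)` be a classical
self-similar Euler profile, `V` smooth, `0 < γ < ½`, with the far-field bounds (3.8).  Assume: (i) an open `U ⊇ 𝒩_W`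
carries a `C¹` drift coordinate `f` (`‖Df(y)W(y)‖ ≤ C‖W(y)‖²` on `U`) injective on `𝒩_W`; (ii) every BAD stagnation
point (`1 ≤ ⟪DV(z)w, w⟫` for some unit `w`) lies in a compact `Kset ⊆ 𝒩_W` at each point of which `DW(z)` has the
dominated real block form (`d₂ < 0`, `d₂ < d₀`, `d₂ < d₁`).  Then `V ≡ 0`.  Proof: every backward trajectory converges
to ONE node (drift); a vortical particle's limit node is bad (typeII-p1's limit-set KILL,
`NodalContinuum.exists_badNode_mapClusterPt_of_curl_ne_zero`), hence in `Kset`; so `{curl V ≠ 0}` lies in the null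
set of `volume_setOf_tendsto_flow_atBot_mem_eq_zero_of_dominatedBlock`, and being open it is empty; harmonic
Liouville and `V(0) = 0` finish. [cite: ConstantinIgnatovaVicol2026Putative, §3.5 Thm 3.10 (strengthened to transversally-saddle stagnation continua with drift control); Robinson1999, Ch. V §5.10.1] -/
theorem eq_zero_of_driftCoordinate_of_dominatedBlock_badNodes (hV : ContDiff ℝ ∞ V)
    (hprof : IsSelfSimilarEulerProfile γ 0 V P) (hγ : 0 < γ) (hγ2 : γ < 1 / 2)
    {C₀ : ℝ} (hfar : HasSelfSimilarFarFieldWith γ 0 C₀ V)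
    {Kset : Set (EuclideanSpace ℝ (Fin 3))} (hKc : IsCompact Kset) (hKN : Kset ⊆ selfSimilarNodalSet γ 0 V)
    (hbad : ∀ z ∈ selfSimilarNodalSet γ 0 V,
      (∃ w : EuclideanSpace ℝ (Fin 3), ‖w‖ = 1 ∧ 1 ≤ ⟪fderiv ℝ V z w, w⟫) → z ∈ Kset)
    (hblock : ∀ z ∈ Kset, ∃ (b : Module.Basis (Fin 3) ℝ (EuclideanSpace ℝ (Fin 3))) (lam : Fin 3 → ℝ) (β : ℝ),
      (γ • ContinuousLinearMap.id ℝ (EuclideanSpace ℝ (Fin 3)) + fderiv ℝ V z) (b 0) = lam 0 • b 0 - β • b 1 ∧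
      (γ • ContinuousLinearMap.id ℝ (EuclideanSpace ℝ (Fin 3)) + fderiv ℝ V z) (b 1) = β • b 0 + lam 1 • b 1 ∧
      (γ • ContinuousLinearMap.id ℝ (EuclideanSpace ℝ (Fin 3)) + fderiv ℝ V z) (b 2) = lam 2 • b 2 ∧
      lam 2 < 0 ∧ lam 2 < lam 0 ∧ lam 2 < lam 1)
    {U : Set (EuclideanSpace ℝ (Fin 3))} (hU : IsOpen U) (hNU : selfSimilarNodalSet γ 0 V ⊆ U)
    {F' : Type*} [NormedAddCommGroup F'] [NormedSpace ℝ F'] [CompleteSpace F']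
    {f : EuclideanSpace ℝ (Fin 3) → F'} (hf : ContDiff ℝ 1 f) {C : ℝ}
    (hdrift : ∀ y ∈ U, ‖fderiv ℝ f y (selfSimilarTransport γ 0 V y)‖ ≤ C * ‖selfSimilarTransport γ 0 V y‖ ^ 2)
    (hinj : InjOn f (selfSimilarNodalSet γ 0 V)) :
    V = 0 := by
  set Φ := ODE.evolutionMap (fun _ : ℝ => selfSimilarTransport γ 0 V) 0 with hΦ
  have hK : ∀ y, ‖fderiv ℝ V y‖ ≤ C₀ := norm_fderiv_le_const_of_farField hγ hfar
  have hM : ∀ y, ‖V y‖ ≤ C₀ := norm_le_const_of_farField hγ (by linarith) hfar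
  have hP : ∀ y, P y ≤ P 0 + C₀ * (1 + C₀) * (γ / (1 - 2 * γ)) :=
    hprof.pressure_le_of_hasSelfSimilarFarFieldWith hγ hγ2 hfar
  have hinj' : InjOn f (selfSimilarNodalSet γ 0 V ∩ U) := hinj.mono inter_subset_left
  have hLip := lipschitzWith_selfSimilarTransport (γ := γ) hV hK
  -- the null set of points converging backward into `Kset`
  have hnull := volume_setOf_tendsto_flow_atBot_mem_eq_zero_of_dominatedBlock hV hK hKc hKN hblock
  -- every vortical point lies in it
  have hsub : {x : EuclideanSpace ℝ (Fin 3) | curl V x ≠ 0} ⊆ {x : EuclideanSpace ℝ (Fin 3) | ∃ z ∈ Kset,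
      Tendsto (fun s => Φ s x) atBot (𝓝 z)} := by
    intro x hx
    -- the backward trajectory of `x` converges to a single node `z`
    have hclU : ∀ z, MapClusterPt z atBot (fun s => Φ s x) → z ∈ U := fun z hz =>
      hNU (mem_nodalSet_of_mapClusterPt_atBot hV hK hprof hM hP hγ hγ2 hz)
    obtain ⟨z, hzN, hz⟩ := tendsto_flow_atBot_of_driftCoordinate hV hK hprof hM hP hγ hγ2 x hU hclU hf hdrift hinj'
    -- a bad node is a backward cluster point (typeII-p1), hence equals `z`
    obtain ⟨z', hz'N, hcl', hbad', -⟩ :=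
      NodalContinuum.exists_badNode_mapClusterPt_of_curl_ne_zero hprof hγ (ne_of_lt hγ2) hfar hLip hx
    have hcl : MapClusterPt z' atBot (fun s => Φ s x) := by
      have e : (fun t : ℝ => ODE.lipschitzFlow hLip x (-t)) = (fun s => Φ s x) ∘ Neg.neg := by
        funext t
        simp only [Function.comp_apply, hΦ, ODE.evolutionMap_const_zero_eq_lipschitzFlow hLip]
      rw [e, mapClusterPt_comp, Filter.map_neg_atTop] at hcl'
      exact hcl'
    have hzz' : z' = z := eq_of_nhds_neBot (hcl.clusterPt.mono hz)
    exact ⟨z, hzz' ▸ hbad z' hz'N hbad', hz⟩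
  -- an open null set is empty
  have hopen : IsOpen {x : EuclideanSpace ℝ (Fin 3) | curl V x ≠ 0} := by
    have hV2 : ContDiff ℝ 2 V := hV.of_le (by norm_cast)
    exact isOpen_ne_fun (differentiable_curl_of_contDiff hV2).continuous continuous_const
  have hzero : volume {x : EuclideanSpace ℝ (Fin 3) | curl V x ≠ 0} = 0 := measure_mono_null hsub hnull
  have hempty : {x : EuclideanSpace ℝ (Fin 3) | curl V x ≠ 0} = ∅ := (hopen.measure_eq_zero_iff volume).1 hzero
  have hcurl : ∀ x, curl V x = 0 := by
    intro x
    by_contra hx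
    have : x ∈ ({x : EuclideanSpace ℝ (Fin 3) | curl V x ≠ 0} : Set _) := hx
    rw [hempty] at this
    exact this
  funext y
  rw [eq_of_curl_eq_zero_of_isDivFree_of_fderiv_tendsto_zero (hV.of_le (by norm_cast)) hcurl hprof.divFree
    (hfar.tendsto_norm_fderiv hγ) y 0, hfar.apply_center]
  rfl

end Summit.NavierStokesRegularity.NavierStokesRegularity.Theorems.PowerGaugeEulerLiouville.Kelvin

end
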